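import Summits.BirchSwinnertonDyer.BirchSwinnertonDyer.Theorems.GenusKolyvaginAtTwoEquivariantKolyvaginExactAtTwoReductionCyclic
import Summits.BirchSwinnertonDyer.Rank1Residual.GaloisImage.KolyvaginPrimeTorsionCount
import Literature.NumberTheory.EllipticCurves.LocalTorsionInvariants
import Literature.NumberTheory.EllipticCurves.GoodReductionUnramifiedProofs
import Literature.NumberTheory.EllipticCurves.GaloisActionProofs
import Literature.NumberTheory.GaloisRepresentations.FrobeniusGeneration
import Literature.NumberTheory.GaloisRepresentations.DecompositionGroupOfCompletion
import HarnessLib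

/-!
# Route `GenusKolyvaginAtTwo`, LINE 6, KEY crux Q3 `EquivariantKolyvaginExactAtTwo`
# (stmt-BirchSwinnertonDyer-24882): `#E(ℚ_ℓ)[n] = #E[n]^{Frob_ℓ}` at a good prime `ℓ ∤ n`, and
# `#E(ℚ_ℓ)[2^M] = 2^M` at a Gross–Kolyvagin prime of index `≥ M` on `Δ < 0` (PROVED)

Helper (seat `bsd-line-gk2-p3` g10, cell `bsd-f1-sign2`; `--supports` the item, closes nothing): the
`ℚ_ℓ`-SIDE of stub S2 of the eigen/`ℚ_ℓ` architecture of Q3 (kernel-status memo v2, evidence #9),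
sequel to `…ReductionCyclic` (reduction side: `Ẽ_ℓ(𝔽_ℓ)[2^M]` cyclic of order `2^M`).

* `natCard_invariants_torsion_adicCompletion_eq` — **`H⁰(ℚ_ℓ, E[n]) = E[n]^{Φ}`** for `W/ℚ` with good
  reduction at the place `v` of `ℓ ∤ n` and `Φ ∈ Γ_ℚ` ANY arithmetic Frobenius at the prime `𝔓₀` of
  `\bar ℤ` cut out by the chosen embedding `ℚ̄ → ℚ̄_ℓ` (`adicCompletionPrime`): the image of
  `Γ_{ℚ_ℓ} → Γ_ℚ` is the decomposition group `D_{𝔓₀}` (`decompositionSubgroup_adicCompletionPrime_eq_range`,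
  Neukirch II (9.6)), `D_{𝔓₀} = ⟨Φ⟩ · I_{𝔓₀} · ker ρ̄_{E,n}` (`exists_eq_frobenius_pow_mul_of_mem_decompositionSubgroup`,
  Neukirch I (9.4)), and `I_{𝔓₀}` acts trivially on `E[n]` (`smul_geomTorsion_eq_of_mem_inertia`, *AEC* VII.4.1).
* `natCard_ker_zsmul_adicCompletion_eq` — **`#E(ℚ_ℓ)[n] = #E[n]^{Φ}`** (through the tree's
  `invariantsTorsionEquivKerZSMul`, `H⁰(ℚ_ℓ, E[n]) = E(ℚ_ℓ)[n]`, Milne I Lemma 3.3; the `ℚ`-algebra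
  structure on `ℚ_ℓ` is the canonical `instAlgebraAdicCompletion`, see the proof).
* `natCard_ker_zsmul_adicCompletion_two_pow_eq` — **`#E(ℚ_ℓ)[2^M] = 2^M` at a Gross–Kolyvagin prime
  (`FrobEqFrobInfty W K 2 ℓ`) of Zhang–Kolyvagin index `≥ M` on a globally minimal curve with
  `Δ < 0`**: `#E[2^M]^{σ₀} = #Ẽ_ℓ(𝔽_ℓ)[2^M]` (`FrobShape.exists_frobenius_natCard_fixed_eq`),
  transported to the conjugate Frobenius at `𝔓₀`, and `#Ẽ_ℓ(𝔽_ℓ)[2^M] = 2^M`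
  (`natCard_torsionBy_reductionAt_two_pow_eq`). With `M = 1`: `#E(ℚ_ℓ)[2] = 2`, so `E(ℚ_ℓ)[2^M]` is
  cyclic of order `2^M` (`KolyvaginEigenPow.isAddCyclic_of_card_torsion_le`) — McCallum's Lemma 5.3 (i)
  over `ℚ_ℓ` at `p = 2` for the `+` part; the twin `E^K` (`−` part) is the same statement for
  `W.quadraticTwist c` once its Gross primes are matched (left to the consumer).

* (appended) `natCard_ker_zsmul_adicCompletion_two_eq` (`#E(ℚ_ℓ)[2] = 2`, no index hypothesis) and
  `isAddCyclic_ker_zsmul_adicCompletion_two_pow` — **`E(ℚ_ℓ)[2^M]` is cyclic, `≃+ ZMod (2^M)`**, at a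
  Gross–Kolyvagin prime of index `≥ M` on `Δ < 0`: McCallum's Lemma 5.3 (i) over `ℚ_ℓ` at `2`, in full.

Everything is PROVED from tree theorems (no named fact, no definition, no `sorry`, standard axioms).
BSD is not proved by any of this.

References: [McCallumLMS1991] §5 Lemma 5.3; [GrossLMS1991] §3 (3.2)–(3.3); [NeukirchANT1999] I §9
(9.4), II §9 (9.6); [MilneADT2006] I Lemma 3.3; [SilvermanAEC2009] Prop. VII.4.1(a), VII.3.1(b).
-/

set_option autoImplicit false
set_option linter.dupNamespace false -- tree convention: `Summit.BirchSwinnertonDyer.BirchSwinnertonDyer.Theorems` (summit = sub-problem)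

noncomputable section

open scoped Classical

namespace Summit.BirchSwinnertonDyer.BirchSwinnertonDyer.Theorems.GenusExact.ReductionCyclic

open WeierstrassCurve NumberField IsDedekindDomain Field
open Literature.NumberTheory.EllipticCurves Literature.NumberTheory.GaloisRepresentations

/-- `K_v` has characteristic `0` (stated for a general number field `K`, so that at `K = ℚ` no
`ℚ`-algebra instance diamond arises). [folklore] -/
theorem charZero_adicCompletion {K : Type*} [Field K] [NumberField K] (v : HeightOneSpectrum (𝓞 K)) :
    CharZero (v.adicCompletion K) :=
  charZero_of_injective_algebraMap (algebraMap K (v.adicCompletion K)).injective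

variable (W : WeierstrassCurve ℚ) [W.IsElliptic]

omit [W.IsElliptic] in
/-- Powers of an element fixing `P` fix `P`. [folklore] -/
theorem pow_smul_eq_of_smul_eq {n : ℤ} {φ : absoluteGaloisGroup ℚ} {P : geomTorsion W n}
    (h : φ • P = P) (k : ℕ) : φ ^ k • P = P := by
  induction k with
  | zero => rw [pow_zero, one_smul]
  | succ k ih => rw [pow_succ, mul_smul, h, ih]

omit [W.IsElliptic] in
/-- Elements of `ker ρ̄_{E,n}` act trivially on `E[n]`. [folklore] -/
theorem smul_eq_of_mem_ker_galoisRepTorsion {n : ℤ} {u : absoluteGaloisGroup ℚ}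
    (hu : u ∈ (galoisRepTorsion W n).ker) (P : geomTorsion W n) : u • P = P := by
  have h := galoisRepTorsion_apply W n u P
  rw [MonoidHom.mem_ker.mp hu] at h
  exact h.symm.trans rfl

/-- **`H⁰(ℚ_ℓ, E[n]) = E[n]^{Φ}` for a Frobenius `Φ` at the prime of `\bar ℤ` cut out by `ℚ̄ → ℚ̄_ℓ`,
`ℓ ∤ n` good.** The image of `Γ_{ℚ_ℓ} → Γ_ℚ` is the decomposition group `D_{𝔓₀}`
(`decompositionSubgroup_adicCompletionPrime_eq_range`), `D_{𝔓₀} = ⟨Φ⟩ · I_{𝔓₀} · ker ρ̄_{E,n}`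
topologically (`exists_eq_frobenius_pow_mul_of_mem_decompositionSubgroup`, Neukirch I (9.4)), and
`I_{𝔓₀}` acts trivially on `E[n]` (good reduction, `ℓ ∤ n`: `smul_geomTorsion_eq_of_mem_inertia`,
*AEC* VII.4.1). So the `Γ_{ℚ_ℓ}`-invariants of `E[n]` are exactly the fixed points of `Φ`, counted.
[cite: SilvermanAEC2009, Prop. VII.4.1(a)] [cite: NeukirchANT1999, I §9 Prop. (9.4), II §9 Prop. (9.6)] -/
theorem natCard_invariants_torsion_adicCompletion_eq [W.IsGloballyMinimal] {n : ℤ} (hn : n ≠ 0)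
    {v : HeightOneSpectrum (𝓞 ℚ)} (hgood : W.HasGoodReductionAt v) (hnv : (n : 𝓞 ℚ) ∉ v.asIdeal)
    {Φ : absoluteGaloisGroup ℚ} (hΦ : IsArithFrobAt (𝓞 ℚ) Φ (adicCompletionPrime ℚ v)) :
    Nat.card (GaloisRep.restrictField (v.adicCompletion ℚ) (W.torsionGaloisModule n)).invariants =
      Nat.card {P : geomTorsion W n // Φ • P = P} := by
  have h𝔓₀ := adicCompletionPrime_mem_primesAbove ℚ v
  have hD : ∀ σ : absoluteGaloisGroup (v.adicCompletion ℚ),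
      absGaloisRestrict ℚ (v.adicCompletion ℚ) σ ∈
        (adicCompletionPrime ℚ v).decompositionSubgroup (absoluteGaloisGroup ℚ) := fun σ ↦ by
    rw [decompositionSubgroup_adicCompletionPrime_eq_range]
    exact ⟨σ, rfl⟩
  have hΦD : Φ ∈ (adicCompletionPrime ℚ v).decompositionSubgroup (absoluteGaloisGroup ℚ) :=
    hΦ.mem_stabilizer
  have hΦrange : ∃ σΦ : absoluteGaloisGroup (v.adicCompletion ℚ),
      absGaloisRestrict ℚ (v.adicCompletion ℚ) σΦ = Φ := by
    have h := hΦD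
    rw [decompositionSubgroup_adicCompletionPrime_eq_range] at h
    exact h
  have hU := isOpen_ker_galoisRepTorsion_holds W hn
  refine Nat.card_congr (Equiv.subtypeEquivRight fun P ↦ ?_)
  rw [ContinuousRep.mem_invariants]
  constructor
  · intro h
    obtain ⟨σΦ, hσΦ⟩ := hΦrange
    have h1 := h σΦ
    rw [restrictField_torsionGaloisModule_apply, hσΦ] at h1
    exact h1
  · intro h σ
    rw [restrictField_torsionGaloisModule_apply]
    obtain ⟨k, i, u, hi, hu, hd⟩ :=
      exists_eq_frobenius_pow_mul_of_mem_decompositionSubgroup h𝔓₀ hΦ hU (hD σ)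
    rw [hd, mul_smul, mul_smul, smul_eq_of_mem_ker_galoisRepTorsion W hu P,
      W.smul_geomTorsion_eq_of_mem_inertia hgood hnv h𝔓₀ hi P, pow_smul_eq_of_smul_eq W h k]

/-- **`#E(ℚ_ℓ)[n] = #E[n]^{Φ}`** (rational `n`-torsion of `W ⊗ ℚ_ℓ` as the kernel of `n •`): the
previous count read through the tree's `invariantsTorsionEquivKerZSMul` (`H⁰(ℚ_ℓ, E[n]) = E(ℚ_ℓ)[n]`,
Milne I Lemma 3.3). [cite: MilneADT2006, I Lemma 3.3] [cite: SilvermanAEC2009, Prop. VII.4.1(a)] -/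
theorem natCard_ker_zsmul_adicCompletion_eq [W.IsGloballyMinimal] {n : ℤ} (hn : n ≠ 0)
    {v : HeightOneSpectrum (𝓞 ℚ)} (hgood : W.HasGoodReductionAt v) (hnv : (n : 𝓞 ℚ) ∉ v.asIdeal)
    {Φ : absoluteGaloisGroup ℚ} (hΦ : IsArithFrobAt (𝓞 ℚ) Φ (adicCompletionPrime ℚ v)) :
    Nat.card (zsmulAddGroupHom n :
        (W.baseChange (v.adicCompletion ℚ)).toAffine.Point →+ _).ker =
      Nat.card {P : geomTorsion W n // Φ • P = P} := by
  haveI := charZero_adicCompletion (K := ℚ) v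
  rw [← natCard_invariants_torsion_adicCompletion_eq W hn hgood hnv hΦ]
  -- the `ℚ`-algebra structure on `ℚ_v` is the canonical one (`instAlgebraAdicCompletion`), fed by
  -- unification (the two `Algebra ℚ ℚ_v` instances of the tree are not definitionally equal)
  exact (Nat.card_congr (@WeierstrassCurve.invariantsTorsionEquivKerZSMul ℚ _ _ W _
    (v.adicCompletion ℚ) _ (_) n _ hn).toEquiv).symm

/-- **`#E(ℚ_ℓ)[2^M] = 2^M` at a Gross–Kolyvagin prime of Kolyvagin index `≥ M` on `Δ(E) < 0`** — the
`ℚ_ℓ`-side of McCallum's Lemma 5.3 (i) *"cyclic groups of order `p^M`"* at `p = 2`: with `Φ` the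
conjugate at `𝔓₀` of the Frobenius `σ₀` of `FrobShape.exists_frobenius_natCard_fixed_eq`
(`#E[2^M]^{σ₀} = #Ẽ_ℓ(𝔽_ℓ)[2^M]`), the previous theorem and `natCard_torsionBy_reductionAt_two_pow_eq`
(`#Ẽ_ℓ(𝔽_ℓ)[2^M] = 2^M`) give `#E(ℚ_ℓ)[2^M] = 2^M`. (Cyclicity of `E(ℚ_ℓ)[2^M]`: `#E(ℚ_ℓ)[2] = 2` by the
case `M = 1` … left to the consumer via `KolyvaginEigenPow.isAddCyclic_of_card_torsion_le`.)
[cite: McCallumLMS1991, §5 Lemma 5.3] [cite: GrossLMS1991, §3 (3.2)–(3.3)] -/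
theorem natCard_ker_zsmul_adicCompletion_two_pow_eq [W.IsGloballyMinimal] (hΔ : W.Δ < 0)
    {K : Type} [Field K] [NumberField K] {ℓ : ℕ} [Fact ℓ.Prime] (hℓ2 : ℓ ≠ 2)
    (hgoodℓ : W.HasGoodReductionAtPrime ℓ) (hℓ : FrobEqFrobInfty W K 2 ℓ)
    {v : HeightOneSpectrum (𝓞 ℚ)} (hv : (ℓ : 𝓞 ℚ) ∈ v.asIdeal) {M : ℕ}
    (hM : M ≤ Zhang2014.kolyvaginIndex W 2 ℓ) :
    Nat.card (zsmulAddGroupHom ((2 ^ M : ℕ) : ℤ) :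
        (W.baseChange (v.adicCompletion ℚ)).toAffine.Point →+ _).ker = 2 ^ M := by
  haveI : Fact (Nat.Prime 2) := ⟨Nat.prime_two⟩
  have hℓp : ℓ.Prime := Fact.out
  -- the place `v` is the place at `ℓ`; good reduction there; `ℓ ∤ 2^M`
  have hvℓ : (Rat.HeightOneSpectrum.primesEquiv v : ℕ) = ℓ := primesEquiv_eq_of_natCast_mem hℓp hv
  have hgood : W.HasGoodReductionAt v :=
    (hasGoodReductionAtPrime_primesEquiv_iff_holds W v ℓ hvℓ).mp hgoodℓ
  have hnv : ((((2 ^ M : ℕ) : ℤ)) : 𝓞 ℚ) ∉ v.asIdeal := by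
    intro hmem
    haveI := v.isPrime
    have h2 : ((2 : ℕ) : 𝓞 ℚ) ∈ v.asIdeal := by
      have hpow : ((2 : 𝓞 ℚ)) ^ M ∈ v.asIdeal := by exact_mod_cast hmem
      exact_mod_cast v.isPrime.mem_of_pow_mem M hpow
    exact hℓ2 (hvℓ.symm.trans (primesEquiv_eq_of_natCast_mem Nat.prime_two h2))
  -- the Frobenius of `FrobShape`, moved to `𝔓₀`
  obtain ⟨σ₀, 𝔓₀', h𝔓₀', hσ₀, hcount⟩ :=
    Summit.BirchSwinnertonDyer.Rank1Residual.GaloisImage.FrobShape.exists_frobenius_natCard_fixed_eq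
      W 2 ℓ hℓ2 hgoodℓ hv
  have h𝔓₀ := adicCompletionPrime_mem_primesAbove ℚ v
  obtain ⟨g, hg⟩ := HeightOneSpectrum.exists_smul_eq_of_mem_primesAbove_holds h𝔓₀' h𝔓₀
  have hΦ : IsArithFrobAt (𝓞 ℚ) (g * σ₀ * g⁻¹) (adicCompletionPrime ℚ v) := hg ▸ hσ₀.conj g
  rw [natCard_ker_zsmul_adicCompletion_eq W (by positivity) hgood hnv hΦ]
  -- fixed points of `g σ₀ g⁻¹` ↔ fixed points of `σ₀`, via `P ↦ g⁻¹ • P`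
  have hcongr : Nat.card {P : geomTorsion W ((2 ^ M : ℕ) : ℤ) // (g * σ₀ * g⁻¹) • P = P} =
      Nat.card {P : geomTorsion W ((2 ^ M : ℕ) : ℤ) // σ₀ • P = P} := by
    refine Nat.card_congr
      { toFun := fun P ↦ ⟨g⁻¹ • P.1, by
          have h := P.2
          rw [mul_smul, mul_smul] at h
          have h' := congrArg (fun Q ↦ g⁻¹ • Q) h
          simpa only [inv_smul_smul] using h'⟩
        invFun := fun Q ↦ ⟨g • Q.1, by rw [mul_smul, mul_smul, inv_smul_smul, Q.2]⟩
        left_inv := fun P ↦ Subtype.ext (smul_inv_smul g P.1)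
        right_inv := fun Q ↦ Subtype.ext (inv_smul_smul g Q.1) }
  rw [hcongr, hcount M]
  exact natCard_torsionBy_reductionAt_two_pow_eq W hΔ hℓ2 hgoodℓ hℓ hv hM

/-! ## `E(ℚ_ℓ)[2^M]` is cyclic of order `2^M` (appended) -/

/-- **`#E(ℚ_ℓ)[2] = 2` at a Gross–Kolyvagin prime of a `Δ < 0` curve** (no index hypothesis):
`#E(ℚ_ℓ)[2] = #E[2]^{Φ} = #Ẽ_ℓ(𝔽_ℓ)[2] = 2`. [cite: GrossLMS1991, §3 (3.2)] [cite: SilvermanAEC2009, Prop. VII.3.1(b)] -/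
theorem natCard_ker_zsmul_adicCompletion_two_eq [W.IsGloballyMinimal] (hΔ : W.Δ < 0)
    {K : Type} [Field K] [NumberField K] {ℓ : ℕ} [Fact ℓ.Prime] (hℓ2 : ℓ ≠ 2)
    (hgoodℓ : W.HasGoodReductionAtPrime ℓ) (hℓ : FrobEqFrobInfty W K 2 ℓ)
    {v : HeightOneSpectrum (𝓞 ℚ)} (hv : (ℓ : 𝓞 ℚ) ∈ v.asIdeal) :
    Nat.card (zsmulAddGroupHom ((2 : ℕ) : ℤ) :
        (W.baseChange (v.adicCompletion ℚ)).toAffine.Point →+ _).ker = 2 := by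
  haveI : Fact (Nat.Prime 2) := ⟨Nat.prime_two⟩
  have hℓp : ℓ.Prime := Fact.out
  have hvℓ : (Rat.HeightOneSpectrum.primesEquiv v : ℕ) = ℓ := primesEquiv_eq_of_natCast_mem hℓp hv
  have hgood : W.HasGoodReductionAt v :=
    (hasGoodReductionAtPrime_primesEquiv_iff_holds W v ℓ hvℓ).mp hgoodℓ
  have hnv : ((((2 : ℕ) : ℤ)) : 𝓞 ℚ) ∉ v.asIdeal := by
    intro hmem
    have h2 : ((2 : ℕ) : 𝓞 ℚ) ∈ v.asIdeal := by exact_mod_cast hmem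
    exact hℓ2 (hvℓ.symm.trans (primesEquiv_eq_of_natCast_mem Nat.prime_two h2))
  obtain ⟨σ₀, 𝔓₀', h𝔓₀', hσ₀, hcount⟩ :=
    Summit.BirchSwinnertonDyer.Rank1Residual.GaloisImage.FrobShape.exists_frobenius_natCard_fixed_eq
      W 2 ℓ hℓ2 hgoodℓ hv
  have h𝔓₀ := adicCompletionPrime_mem_primesAbove ℚ v
  obtain ⟨g, hg⟩ := HeightOneSpectrum.exists_smul_eq_of_mem_primesAbove_holds h𝔓₀' h𝔓₀
  have hΦ : IsArithFrobAt (𝓞 ℚ) (g * σ₀ * g⁻¹) (adicCompletionPrime ℚ v) := hg ▸ hσ₀.conj g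
  rw [natCard_ker_zsmul_adicCompletion_eq W (by norm_num) hgood hnv hΦ]
  have hcongr : Nat.card {P : geomTorsion W ((2 : ℕ) : ℤ) // (g * σ₀ * g⁻¹) • P = P} =
      Nat.card {P : geomTorsion W ((2 : ℕ) : ℤ) // σ₀ • P = P} := by
    refine Nat.card_congr
      { toFun := fun P ↦ ⟨g⁻¹ • P.1, by
          have h := P.2
          rw [mul_smul, mul_smul] at h
          have h' := congrArg (fun Q ↦ g⁻¹ • Q) h
          simpa only [inv_smul_smul] using h'⟩
        invFun := fun Q ↦ ⟨g • Q.1, by rw [mul_smul, mul_smul, inv_smul_smul, Q.2]⟩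
        left_inv := fun P ↦ Subtype.ext (smul_inv_smul g P.1)
        right_inv := fun Q ↦ Subtype.ext (inv_smul_smul g Q.1) }
  have h1 := hcount 1
  rw [pow_one] at h1
  rw [hcongr, h1]
  exact Summit.BirchSwinnertonDyer.BirchSwinnertonDyer.Theorems.GenusKolySign.natCard_twoTorsion_reductionAt_eq_two_of_frobEqFrobInfty_of_Δ_neg
    W hΔ hℓ2 hgoodℓ hℓ hv

/-- **`E(ℚ_ℓ)[2^M]` is CYCLIC OF ORDER `2^M` at a Gross–Kolyvagin prime of index `≥ M` on `Δ < 0`**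
— McCallum's Lemma 5.3 (i) over `ℚ_ℓ` at `p = 2`, `+` part, in full: the finite group `E(ℚ_ℓ)[2^M]`
(order `2^M`, `natCard_ker_zsmul_adicCompletion_two_pow_eq`) has at most `2` elements killed by `2`
(`natCard_ker_zsmul_adicCompletion_two_eq`), hence is cyclic (`KolyvaginEigenPow.isAddCyclic_of_card_torsion_le`)
and `≃+ ZMod (2^M)`. [cite: McCallumLMS1991, §5 Lemma 5.3] [cite: GrossLMS1991, §3 (3.2)–(3.3)] -/
theorem isAddCyclic_ker_zsmul_adicCompletion_two_pow [W.IsGloballyMinimal] (hΔ : W.Δ < 0)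
    {K : Type} [Field K] [NumberField K] {ℓ : ℕ} [Fact ℓ.Prime] (hℓ2 : ℓ ≠ 2)
    (hgoodℓ : W.HasGoodReductionAtPrime ℓ) (hℓ : FrobEqFrobInfty W K 2 ℓ)
    {v : HeightOneSpectrum (𝓞 ℚ)} (hv : (ℓ : 𝓞 ℚ) ∈ v.asIdeal) {M : ℕ}
    (hM : M ≤ Zhang2014.kolyvaginIndex W 2 ℓ) :
    IsAddCyclic (zsmulAddGroupHom ((2 ^ M : ℕ) : ℤ) :
        (W.baseChange (v.adicCompletion ℚ)).toAffine.Point →+ _).ker ∧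
      Nonempty ((zsmulAddGroupHom ((2 ^ M : ℕ) : ℤ) :
        (W.baseChange (v.adicCompletion ℚ)).toAffine.Point →+ _).ker ≃+ ZMod (2 ^ M)) := by
  set G := (zsmulAddGroupHom ((2 ^ M : ℕ) : ℤ) :
    (W.baseChange (v.adicCompletion ℚ)).toAffine.Point →+ _).ker with hG
  have hcard : Nat.card G = 2 ^ M :=
    natCard_ker_zsmul_adicCompletion_two_pow_eq W hΔ hℓ2 hgoodℓ hℓ hv hM
  haveI : Finite G := Nat.finite_of_card_ne_zero (by rw [hcard]; positivity)
  have h2 := natCard_ker_zsmul_adicCompletion_two_eq W hΔ hℓ2 hgoodℓ hℓ hv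
  have hkill : ∀ x : G, 2 ^ M • x = 0 := fun x ↦ by
    apply Subtype.ext
    have hx : (((2 ^ M : ℕ) : ℤ)) • (x : (W.baseChange (v.adicCompletion ℚ)).toAffine.Point) = 0 := x.2
    rw [natCast_zsmul] at hx
    rw [AddSubmonoidClass.coe_nsmul, ZeroMemClass.coe_zero]
    exact hx
  haveI : Finite (zsmulAddGroupHom ((2 : ℕ) : ℤ) :
      (W.baseChange (v.adicCompletion ℚ)).toAffine.Point →+ _).ker :=
    Nat.finite_of_card_ne_zero (by rw [h2]; norm_num)
  have hle : Nat.card {x : G // 2 • x = 0} ≤ 2 := by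
    have hinj : Nat.card {x : G // 2 • x = 0} ≤ Nat.card (zsmulAddGroupHom ((2 : ℕ) : ℤ) :
        (W.baseChange (v.adicCompletion ℚ)).toAffine.Point →+ _).ker := by
      refine Nat.card_le_card_of_injective
        (fun x ↦ ⟨((x.1 : G) : (W.baseChange (v.adicCompletion ℚ)).toAffine.Point), by
          change (((2 : ℕ) : ℤ)) • ((x.1 : G) : (W.baseChange (v.adicCompletion ℚ)).toAffine.Point) = 0
          rw [natCast_zsmul]
          have h := congrArg Subtype.val x.2
          simpa only [AddSubmonoidClass.coe_nsmul, ZeroMemClass.coe_zero] using h⟩) ?_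
      intro x y h
      have h' := congrArg Subtype.val h
      exact Subtype.ext (Subtype.ext h')
    exact hinj.trans h2.le
  have hcyc : IsAddCyclic G :=
    KolyvaginEigenPow.isAddCyclic_of_card_torsion_le (p := 2) (M := M) Nat.prime_two hkill hle
  exact ⟨hcyc, ⟨(hcard ▸ (zmodAddCyclicAddEquiv hcyc).symm :)⟩⟩

end Summit.BirchSwinnertonDyer.BirchSwinnertonDyer.Theorems.GenusExact.ReductionCyclic

end
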